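/-
Copyright (c) 2026 the pub-hodgecm-mathlib formalisation cell (harness21).  Prover seat hodgecm-mathlib-LH4-p06 (g5), Track A «(D-RAM) FOUR-FRAME», unit U2H, census leaf
(ρ2b′-X) `stub_U2H_fixedPointCensus_typeTwo_unit0` — SOCKET (C) `orderCountCensusC` (type RamM), hand (C-2) «DEP∕TOP dischargers of ★ p857711's `hvTop`» (LH4-p04 (g5)
SOCKET (C) LEAD LINE #1, dealer LH4-plan (g12) WORD #30), FILE (V-top): THE LITERAL `hvTop` LETTER, BOTH TABLES.  2026-09-04.
-/
import Summits.HodgeConjecture.HodgeConjecture.Theorems.F0P3cDyRamToricLevelCensusRamMTopCellsLaw   -- (L, this seat): `twistNear_iff_censusBit` ∕ `anchoredNear_iff_censusBit`; brings ★ bridges p857886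
import Summits.HodgeConjecture.HodgeConjecture.Theorems.F0P3cDyRamToricLevelCensusRamMTopCells      -- (V, this seat): `ncard_levelSetDep_top_cast_eq_of_bit` (the value against any bit)
import HarnessLib

/-!
# T5c (C-2, V-top): ★ `toricCensusSum_ramM`'s `hvTop` letter VERBATIM for `vP j a := #levelSetDep_h(j,a;λ−u)` and `vM j a := #levelSetDep_{h′}(j,a;λ−u)`

Cell `hodgecm-mathlib` (D-0151), FLOOR 0, crux H413 = `stmt-HodgeConjecture-24833`; squad F0∕P3c∕LH4; lane `--supports stmt-HodgeConjecture-24833 --as helper` (count-neutral).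
THEOREMS ONLY (no `def`, no instance, no notation, no `sorry`, default heartbeats).  Socket served: LH4-p04 (g5)'s SOCKET (C) `orderCountCensusC`, brick (C-2) «TOP»: on the
coincidence diagonal `j + m = jλ + a`, `¬GEN`, `j ≤ jλ`,
* **`ncard_levelSetDep_top_cast_eq_hvTop_of_translator`** — for a scalar `h` whose diagonal class `η = (ρh∕h)·t(α^{k₀})` (`v_h + d_ρ + 2k₀ + 2jλ = 2m`) has a unit TRANSLATOR
  `η·t(ω₀) = −1` (the hyperbolic line): `#levelSetDep_h(j,a;λ−u) = if 2j + (g+s0) ≤ 2jλ + 1 ∧ (j + a + 2 ≤ m + s0 + 2g ∨ SideT) then ‹value› else 0`;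
* **`ncard_levelSetDep_top_cast_eq_hvTop_of_anchor`** — for a scalar `h′` whose diagonal class has a unit ANCHOR `η′·t(ω₀)·ψ(n₀) = −1` (`n₀` the `Θ`-fixed unit non-norm;
  the anisotropic line): the same with `SideE`;
`‹value› = if j + a < m + s0 then q^j else (if 2g ≤ k′+1 then 2 else 1)·q^{j − (k′+1)∕2}`, `k′ = j + a − m − s0` — i.e. ★ p857711's `hvTop` with `ε = 1` ∕ `ε = −1` read as the
side letters `SideT ∕ SideE` of (L) (`TP(c″) → SideT`, `TE(c″) → SideE`, `¬(SideT ∧ SideE)` at the one reference far cell `c″ = s0 + 2g − 1`; the (C-5) sign dictionary).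
Proof = (V) `ncard_levelSetDep_top_cast_eq_of_bit` with `Bit` the census bit, the equivalence being ★ bridge p857886 (`topBit_iff_twistNear_ramified` ∕ `_anchoredNear_`)
followed by (L) `twistNear_iff_censusBit` ∕ `anchoredNear_iff_censusBit` at `c = j + a − m` and the diagonal arithmetic `c = 2j − jλ`.
LETTERS THE CONSUMER SUPPLIES: the ρ-, Θ-, τ-data and fourth-field `P, d_K`; the third-field package (complete DVR image, `#𝓀 = q`); `hFN`; `n₀`; `|ϖE| = exp(−2)`, `ρϖE = ϖE`,
`#𝓀_M = q`, `2 ∣ q`; `h ≠ 0`, `|h| = exp(−v_h)`; `μ = λ − u` (`λΘλ = 1`, `ρu = u`, `uΘu = 1`) with the tokens; the dictionary `dΘ = 2g`, `dτ = 2s0`, `2d′ = d_ρ + dτ`,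
`2d_K = d_ρ + 2g`; the REGIME token `m + s0 ≤ jλ ∨ m + 1 ≤ g + s0` and `2s0 + g ≤ jλ + 2` (see (L) for why it is necessary); the class letter; the side letters.
HONEST LABEL.  Count-neutral (`--supports`); unconditional local algebra; nothing of (ρ2b′-X) is asserted — `HC_CM` is proved only modulo the 7 printed citations (2 remaining named
inputs: hLiu418 = `stmt-HodgeConjecture-24832`, h413 = `stmt-HodgeConjecture-24833`) until rung 0 closes.

## References
* [Flicker1998UnitaryFL] Y. Z. Flicker, *Elementary proof of the fundamental lemma for a unitary group*, Canad. J. Math. 50 (1998): Prop. 7 p. 84 (the level tables).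
* [Kottwitz1986BaseChangeUnits] R. E. Kottwitz, *Base change for unit elements of Hecke algebras*, Compositio Math. 60 (1986): §1 pp. 240–241.
* [Jacobowitz1962] R. Jacobowitz, *Hermitian forms over local fields*, Amer. J. Math. 84 (1962): §4.
* [Serre1979] J.-P. Serre, *Local Fields*, GTM 67 (1979): Ch. V §3 Prop. 5, Cor. 3.
-/

set_option autoImplicit false

noncomputable section

namespace Summit.HodgeConjecture.HodgeConjecture.Cruxes.H413.F0P3cDyRamToricLevelCensusRamM

open WithZero IsLocalRing
open scoped Valued
open Literature.NumberTheory.Automorphic.UnitaryThreeFourFrame (IsRamifiedQuadraticDatum)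
open Literature.NumberTheory.LocalFields.QuadraticOrder Literature.NumberTheory.LocalFields.WildQuadraticDatum
open Summit.HodgeConjecture.HodgeConjecture.Cruxes.H413.F0P3cDyRamToricCensusDefs

variable {K : Type} [Field K] [Valued K ℤᵐ⁰] {ρ Θ τ : K →+* K} {α ϖE h : K} {dρ t dτ tτ : ℕ}
variable {K' : Type*} [Field K'] [Valued K' ℤᵐ⁰] {σ' : K' →+* K'} {π' : K'} {d' : ℕ}

/-- **★ p857711's `hvTop`, THE `+` TABLE (translator class).** [cite: Flicker1998UnitaryFL, Prop. 7 p. 84] [cite: Kottwitz1986BaseChangeUnits, §1 pp. 240–241]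
[cite: Jacobowitz1962, §4] [cite: Serre1979, Ch. V §3 Prop. 5, Cor. 3] -/
theorem ncard_levelSetDep_top_cast_eq_hvTop_of_translator [CompleteSpace K] [IsDiscreteValuationRing 𝒪[K]] [Finite 𝓀[K]]
    [IsDiscreteValuationRing 𝒪[K']] [Finite 𝓀[K']]
    (hD : IsRamifiedQuadraticDatum ρ α dρ t) (hΘρ : ∀ x, Θ (ρ x) = ρ (Θ x)) (hvΘ : ∀ x, Valued.v (Θ x) = Valued.v x)
    (hτ : ∀ x, τ x = Θ (ρ x)) (hDτ : IsRamifiedQuadraticDatum τ α dτ tτ)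
    {P : K} (hτP : τ P = P) (hP : Valued.v P = exp (-2 : ℤ)) {dK : ℕ} (hdK : Valued.v (P - ρ P) = exp (-(2 * (dK : ℤ))))
    (hσ' : ∀ x, σ' (σ' x) = x) (hvσ' : ∀ x, Valued.v (σ' x) = Valued.v x) (hfix' : ∀ x : K', σ' x = x → x ≠ 0 → ∃ n : ℤ, Valued.v x = exp (2 * n))
    (hπ' : Valued.v π' = exp (-1 : ℤ)) (hdd' : Valued.v (π' - σ' π') = Valued.v π' ^ d')
    (jK : K' →+* K) (hjle : ∀ x y : K', Valued.v (jK x) ≤ Valued.v (jK y) ↔ Valued.v x ≤ Valued.v y) (hjΘ : ∀ x, Θ (jK x) = jK x)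
    (hjfix : ∀ z : K, Θ z = z → ∃ x, jK x = z) (hjσ : ∀ x, jK (σ' x) = ρ (jK x)) (hjπ : Valued.v (jK π') = exp (-2 : ℤ))
    {ϖ : K} {dΘ tΘ : ℕ} (hDΘ : IsRamifiedQuadraticDatum Θ ϖ dΘ tΘ)
    (hFN : ∀ f : K, ρ f = f → Θ f = f → Valued.v f = 1 → ∃ x : K, x * Θ x = f)
    {n₀ : K} (hΘn₀ : Θ n₀ = n₀) (hn₀1 : Valued.v n₀ = 1) (hn₀N : ¬ ∃ z : K, z * Θ z = n₀)
    (hϖE : Valued.v ϖE = exp (-2 : ℤ)) (hρϖ : ρ ϖE = ϖE) {q : ℕ} (hq : Nat.card 𝓀[K] = q) (hq' : Nat.card 𝓀[K'] = q) (hq2 : 2 ∣ q)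
    (hh : h ≠ 0) {vh : ℤ} (hvh : Valued.v h = exp (-vh))
    {lam u : K} (hlam : lam * Θ lam = 1) (hu : ρ u = u) (hu1 : u * Θ u = 1)
    {m jl : ℕ} (hμ : Valued.v (lam - u) = Valued.v ϖE ^ m) (hjl : Valued.v ((lam - u) - ρ (lam - u)) = Valued.v (ϖE ^ jl * (α - ρ α)))
    {g s0 : ℕ} (hg : dΘ = 2 * g) (hs0 : dτ = 2 * s0) (hd' : 2 * d' = dρ + dτ) (hdK2 : 2 * dK = dρ + 2 * g)
    (hAB : m + s0 ≤ jl ∨ m + 1 ≤ g + s0) (hjlS : 2 * s0 + g ≤ jl + 2) (SideT : Prop) [Decidable SideT] (SideE : Prop)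
    (hST : (∃ ω : K, Valued.v ω = 1 ∧ Valued.v (ρ (lam - u) / (lam - u) * (ρ (ω * Θ ω) / (ω * Θ ω)) - 1) ≤ exp (-(2 * ((s0 : ℤ) + 2 * g - 1) + dρ))) → SideT)
    (hSE : (∃ ω : K, Valued.v ω = 1 ∧
      Valued.v (ρ (lam - u) / (lam - u) * (ρ n₀ / n₀) * (ρ (ω * Θ ω) / (ω * Θ ω)) - 1) ≤ exp (-(2 * ((s0 : ℤ) + 2 * g - 1) + dρ))) → SideE)
    (hTE : ¬ (SideT ∧ SideE))
    {k₀ : ℤ} (hk₀ : vh + dρ + 2 * k₀ + 2 * jl = 2 * m) {ω₀ : Kˣ} (hω₀ : Valued.v (ω₀ : K) = 1)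
    (hη : ρ h / h * (ρ (α ^ k₀ * Θ (α ^ k₀)) / (α ^ k₀ * Θ (α ^ k₀))) * (ρ ((ω₀ : K) * Θ ω₀) / ((ω₀ : K) * Θ ω₀)) = -1)
    {j a : ℕ} (hj : j ≤ jl) (hng : ¬ (a ≤ m ∧ (j + a ≤ m ∨ (2 * a ≤ m ∧ j + a ≤ jl)))) (hdiag : j + m = jl + a) :
    ((levelSetDep ρ Θ α ϖE h j a (lam - u)).ncard : ℚ) =
      if 2 * j + (g + s0) ≤ 2 * jl + 1 ∧ (j + a + 2 ≤ m + s0 + 2 * g ∨ SideT) then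
        (if j + a < m + s0 then (q : ℚ) ^ j else (if 2 * g ≤ j + a - m - s0 + 1 then 2 else 1) * (q : ℚ) ^ (j - (j + a - m - s0 + 1) / 2)) else 0 := by
  have hbit : (∃ ω₁ : Kˣ, Valued.v (ω₁ : K) = 1 ∧
      Valued.v (1 + ρ h / h * (ρ (α ^ k₀ * Θ (α ^ k₀)) / (α ^ k₀ * Θ (α ^ k₀))) / (ρ (lam - u) / (lam - u)) * (ρ ((ω₁ : K) * Θ ω₁) / ((ω₁ : K) * Θ ω₁))) ≤
        exp (2 * (m : ℤ) - 2 * a - 2 * j - dρ)) ↔ 2 * j + (g + s0) ≤ 2 * jl + 1 ∧ (j + a + 2 ≤ m + s0 + 2 * g ∨ SideT) := by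
    rw [topBit_iff_twistNear_ramified hD hvΘ hϖE hω₀ hη hμ j a, show (2 * (m : ℤ) - 2 * a - 2 * j - dρ) = -(2 * ((j + a - m : ℕ) : ℤ) + dρ) by omega,
      twistNear_iff_censusBit hD hΘρ hvΘ hτ hDτ hτP hP hdK hσ' hvσ' hfix' hπ' hdd' jK hjle hjΘ hjfix hjσ hjπ hDΘ hFN hΘn₀ hn₀1 hn₀N hϖE hlam hu hu1 hμ hjl
        hg hs0 hd' hdK2 hAB hjlS SideT SideE hST hSE hTE (j + a - m)]
    constructor <;> rintro ⟨h1, h2⟩ <;> exact ⟨by omega, h2.imp_left fun h3 => by omega⟩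
  have hval := ncard_levelSetDep_top_cast_eq_of_bit hD hΘρ hvΘ hϖE hρϖ hq hq' hq2 hσ' hvσ' hfix' hπ' hdd' jK hjle hjΘ hjfix hjσ hjπ hDΘ hFN hh hvh hμ hjl hg hs0 hd'
    hk₀ hj hng hdiag _ hbit
  rw [hval]; congr 1

/-- **★ p857711's `hvTop`, THE `−` TABLE (anchored class).** [cite: Flicker1998UnitaryFL, Prop. 7 p. 84] [cite: Kottwitz1986BaseChangeUnits, §1 pp. 240–241]
[cite: Jacobowitz1962, §4] [cite: Serre1979, Ch. V §3 Prop. 5, Cor. 3] -/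
theorem ncard_levelSetDep_top_cast_eq_hvTop_of_anchor [CompleteSpace K] [IsDiscreteValuationRing 𝒪[K]] [Finite 𝓀[K]]
    [IsDiscreteValuationRing 𝒪[K']] [Finite 𝓀[K']]
    (hD : IsRamifiedQuadraticDatum ρ α dρ t) (hΘρ : ∀ x, Θ (ρ x) = ρ (Θ x)) (hvΘ : ∀ x, Valued.v (Θ x) = Valued.v x)
    (hτ : ∀ x, τ x = Θ (ρ x)) (hDτ : IsRamifiedQuadraticDatum τ α dτ tτ)
    {P : K} (hτP : τ P = P) (hP : Valued.v P = exp (-2 : ℤ)) {dK : ℕ} (hdK : Valued.v (P - ρ P) = exp (-(2 * (dK : ℤ))))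
    (hσ' : ∀ x, σ' (σ' x) = x) (hvσ' : ∀ x, Valued.v (σ' x) = Valued.v x) (hfix' : ∀ x : K', σ' x = x → x ≠ 0 → ∃ n : ℤ, Valued.v x = exp (2 * n))
    (hπ' : Valued.v π' = exp (-1 : ℤ)) (hdd' : Valued.v (π' - σ' π') = Valued.v π' ^ d')
    (jK : K' →+* K) (hjle : ∀ x y : K', Valued.v (jK x) ≤ Valued.v (jK y) ↔ Valued.v x ≤ Valued.v y) (hjΘ : ∀ x, Θ (jK x) = jK x)
    (hjfix : ∀ z : K, Θ z = z → ∃ x, jK x = z) (hjσ : ∀ x, jK (σ' x) = ρ (jK x)) (hjπ : Valued.v (jK π') = exp (-2 : ℤ))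
    {ϖ : K} {dΘ tΘ : ℕ} (hDΘ : IsRamifiedQuadraticDatum Θ ϖ dΘ tΘ)
    (hFN : ∀ f : K, ρ f = f → Θ f = f → Valued.v f = 1 → ∃ x : K, x * Θ x = f)
    {n₀ : K} (hΘn₀ : Θ n₀ = n₀) (hn₀1 : Valued.v n₀ = 1) (hn₀N : ¬ ∃ z : K, z * Θ z = n₀)
    (hϖE : Valued.v ϖE = exp (-2 : ℤ)) (hρϖ : ρ ϖE = ϖE) {q : ℕ} (hq : Nat.card 𝓀[K] = q) (hq' : Nat.card 𝓀[K'] = q) (hq2 : 2 ∣ q)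
    (hh : h ≠ 0) {vh : ℤ} (hvh : Valued.v h = exp (-vh))
    {lam u : K} (hlam : lam * Θ lam = 1) (hu : ρ u = u) (hu1 : u * Θ u = 1)
    {m jl : ℕ} (hμ : Valued.v (lam - u) = Valued.v ϖE ^ m) (hjl : Valued.v ((lam - u) - ρ (lam - u)) = Valued.v (ϖE ^ jl * (α - ρ α)))
    {g s0 : ℕ} (hg : dΘ = 2 * g) (hs0 : dτ = 2 * s0) (hd' : 2 * d' = dρ + dτ) (hdK2 : 2 * dK = dρ + 2 * g)
    (hAB : m + s0 ≤ jl ∨ m + 1 ≤ g + s0) (hjlS : 2 * s0 + g ≤ jl + 2) (SideT SideE : Prop) [Decidable SideE]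
    (hST : (∃ ω : K, Valued.v ω = 1 ∧ Valued.v (ρ (lam - u) / (lam - u) * (ρ (ω * Θ ω) / (ω * Θ ω)) - 1) ≤ exp (-(2 * ((s0 : ℤ) + 2 * g - 1) + dρ))) → SideT)
    (hSE : (∃ ω : K, Valued.v ω = 1 ∧
      Valued.v (ρ (lam - u) / (lam - u) * (ρ n₀ / n₀) * (ρ (ω * Θ ω) / (ω * Θ ω)) - 1) ≤ exp (-(2 * ((s0 : ℤ) + 2 * g - 1) + dρ))) → SideE)
    (hTE : ¬ (SideT ∧ SideE))
    {k₀ : ℤ} (hk₀ : vh + dρ + 2 * k₀ + 2 * jl = 2 * m) {ω₀ : Kˣ} (hω₀ : Valued.v (ω₀ : K) = 1)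
    (hη : ρ h / h * (ρ (α ^ k₀ * Θ (α ^ k₀)) / (α ^ k₀ * Θ (α ^ k₀))) * (ρ ((ω₀ : K) * Θ ω₀) / ((ω₀ : K) * Θ ω₀)) * (ρ n₀ / n₀) = -1)
    {j a : ℕ} (hj : j ≤ jl) (hng : ¬ (a ≤ m ∧ (j + a ≤ m ∨ (2 * a ≤ m ∧ j + a ≤ jl)))) (hdiag : j + m = jl + a) :
    ((levelSetDep ρ Θ α ϖE h j a (lam - u)).ncard : ℚ) =
      if 2 * j + (g + s0) ≤ 2 * jl + 1 ∧ (j + a + 2 ≤ m + s0 + 2 * g ∨ SideE) then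
        (if j + a < m + s0 then (q : ℚ) ^ j else (if 2 * g ≤ j + a - m - s0 + 1 then 2 else 1) * (q : ℚ) ^ (j - (j + a - m - s0 + 1) / 2)) else 0 := by
  have hbit : (∃ ω₁ : Kˣ, Valued.v (ω₁ : K) = 1 ∧
      Valued.v (1 + ρ h / h * (ρ (α ^ k₀ * Θ (α ^ k₀)) / (α ^ k₀ * Θ (α ^ k₀))) / (ρ (lam - u) / (lam - u)) * (ρ ((ω₁ : K) * Θ ω₁) / ((ω₁ : K) * Θ ω₁))) ≤
        exp (2 * (m : ℤ) - 2 * a - 2 * j - dρ)) ↔ 2 * j + (g + s0) ≤ 2 * jl + 1 ∧ (j + a + 2 ≤ m + s0 + 2 * g ∨ SideE) := by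
    rw [topBit_iff_anchoredNear_ramified hD hvΘ hϖE hω₀ hn₀1 hη hμ j a, show (2 * (m : ℤ) - 2 * a - 2 * j - dρ) = -(2 * ((j + a - m : ℕ) : ℤ) + dρ) by omega,
      anchoredNear_iff_censusBit hD hΘρ hvΘ hτ hDτ hτP hP hdK hσ' hvσ' hfix' hπ' hdd' jK hjle hjΘ hjfix hjσ hjπ hDΘ hFN hΘn₀ hn₀1 hn₀N hϖE hlam hu hu1 hμ hjl
        hg hs0 hd' hdK2 hAB hjlS SideT SideE hST hSE hTE (j + a - m)]
    constructor <;> rintro ⟨h1, h2⟩ <;> exact ⟨by omega, h2.imp_left fun h3 => by omega⟩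
  have hval := ncard_levelSetDep_top_cast_eq_of_bit hD hΘρ hvΘ hϖE hρϖ hq hq' hq2 hσ' hvσ' hfix' hπ' hdd' jK hjle hjΘ hjfix hjσ hjπ hDΘ hFN hh hvh hμ hjl hg hs0 hd'
    hk₀ hj hng hdiag _ hbit
  rw [hval]; congr 1

end Summit.HodgeConjecture.HodgeConjecture.Cruxes.H413.F0P3cDyRamToricLevelCensusRamM

end
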